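import Mathlib
import Literature.Computability.AlgebraicComplexity.NewtonPolygonTauBounds
import Summits.ValiantsHypothesis.ValiantsHypothesis.Theses.NewtonUnitEquations
import Summits.ValiantsHypothesis.ValiantsHypothesis.Theses.NewtonFrames

/-!
# Line `slope-ladder` for crux `NewtonTauWeak` (stmt-ValiantsHypothesis-5904; decl `Theses.NewtonFrames.NewtonTauWeak`, shared verbatim with the CLOSED route's `Theses.NewtonUnitEquations.NewtonTauWeak`) — FORWARD LADDER (G4, ladder-down)

Forward-generator line (planner-fwd-ladder-ValiantsHypothesis-51-0, 2026-08-17).  Card: `Lines/slope-ladder.md`;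
ladder: `LADDER-NewtonTauWeak.md`; witness file: `Lines/BeatTwoThirds_special.lean`.

RE-REGISTERED 2026-08-27 (planner-val-width-lines-3-g0, cell val-width, director-valiant REQUESTS l.20032 (d)) — mathematics
unchanged; two bookkeeping repairs so the line is usable by `--supports` provers:
* the three stub STATEMENTS are now written out IN FULL over tree-visible constants (Mathlib + `Literature…newtonVertexCount` +
  the Theses decl) instead of the line-local abbreviations `BlockConvexBound` / `BeatTwoThirds` / `ResidualSlope` (the registered
  signature is the literal statement text, and a `propose --supports stmt-ValiantsHypothesis-5904` file must restate it verbatim —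
  it cannot import this Cruxes file); the abbreviations stay as `def`s and the compositions typecheck by `δ`-unfolding;
* the skeleton now concludes the OPEN route's decl `Summit.ValiantsHypothesis.ValiantsHypothesis.Theses.NewtonFrames.NewtonTauWeak`
  (route-ValiantsHypothesis-NewtonFrames; route-ValiantsHypothesis-NewtonUnitEquations closed `refuted` 2026-08-20 on another item).
  The item is shared and both decls have the same body, so `NewtonTauWeak_proof_unitEquations` still concludes the old decl by name.
VP ≠ VNP is not moved by any of this: the rung `BeatTwoThirds` is FRONTIER-disposition convex geometry (see below).

THE LADDER IN ONE LINE.  Grade the crux by the EXPONENT SLOPE `c` of the sparsity `t` against the number of factors `m`: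

    SlopeBound c :  vert(Σ_{i<k} Π_{j<m} f_ij) ≤ C · (k+2)^b · 2^{b m} · (t+2)^b · (t+2)^{c·m}     (f_ij t-sparse over ℂ).

* slope `1`   — the trivial support count `k·t^m` (`slopeBound_one`, PROVED here);
* slope `2/3` — KPTT Theorem 6, `O(k·t^{2m/3})`, via the Eisenbrand–Pach–Rothvoß–Sopher bound for convexly independent
  subsets of `P + Q` [KoiranPortierTavenasThomasse2015, Thm 6; doi:10.37236/883] — IN TREE as
  `Literature.Computability.AlgebraicComplexity.KPTT.theorem6_holds`; it is the FLOOR, `slopeBound_two_thirds` (PROVED here, F3 witness);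
* slope `0`   — the crux `NewtonTauWeak` itself (`2^{a m}(k t+2)^b`); on-path `NewtonTauWeak → SlopeBound c` for every `c ≥ 0`
  (`slopeBound_of_newtonTauWeak`, PROVED), hence `NewtonTauWeak → BeatTwoThirds` (`beatTwoThirds_of_newtonTauWeak`).

THE RUNG (this line's target, NOT the crux):  `BeatTwoThirds := ∃ c < 2/3, SlopeBound c` — beat the EPRS/KPTT slope by any
fixed amount.  Further rungs of the same family, typed: `SlopeBound (1/2)`, `SlopeBound (1/3)` (= the ceiling of every
Minkowski-convexity argument: KPTT Prop. 1, `M_m(t) ≥ t^{m/3} - 1`), `SubLinear := ∀ c > 0, SlopeBound c`; monotone chain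
`SubLinear → SlopeBound (1/3) → SlopeBound (1/2) → BeatTwoThirds` PROVED.  gap_after (prose, not an item — F1): from `SubLinear`
(t-exponent `o(m)`) to the crux (t-exponent `O(1)`) through `NewtonTauRoot` (stmt-18547, exponent `O(√m)`); by the crux dossier's
census S-J(iii) a vertex bound transfers to `PER ∉ VP` iff its `(kt)`-exponent is `o(m / log m)`, so NO rung of this ladder decides
the summit: disposition FRONTIER (bankable convex geometry; it is the [BBFKOTT10, §5] open problem "determine `M_k(n)`, `k ≥ 3`").

STUBS (registered; `sorry` only there):
* `stub_blockConvexBound` (HARDEST, open convex geometry): for SOME number of blocks `r ≥ 2` and some `δ > 0`, every convexly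
  independent subset of an `r`-fold Minkowski sum of planar `N`-sets has `≤ C (N+2)^{(2/3-δ) r}` points.  FALSE for `r = 2`
  (Bílka–Buchin–Fulek–Kiyomi–Okamoto–Tanigawa–Tóth 2010, `M_2(N) = Θ(N^{4/3})`, doi:10.37236/484) and for `r = 3` (this line's card §3:
  `A = {(i,(1+ε)i²)}`, `B = {(j,-(1-ε)j²)}`, `Q` = one translation per difference class `j - i` gives `N²` points of `A+B+Q` on a strictly
  convex chain, so `M_3(N) = Θ(N²)`), hence the content is `r ≥ 4`, where an `(r-1)`-parameter algebraic family can no longer be convex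
  (`N^{r-1} > N^{2r/3}`); unknown in print for every `r ≥ 4` (Martínez-Sandoval–Padrol 2021, arXiv:1909.01189 §7).
* `stub_blocking` (M/L, provable now): `BlockConvexBound → BeatTwoThirds` — KPTT's proof of Theorem 6 with `r` blocks instead of `2`:
  group the `m` factors of each product into `r` blocks of `≤ ⌈m/r⌉` factors, expand each block by brute force (`N = t^{⌈m/r⌉}`-sparse,
  `KPTT.card_support_prod_univ_le_pow`), the hull vertices lying in product `i` form a convexly independent subset of the `r`-fold sum of the
  block supports (as in `KPTT.theorem5_of_minkowski_convexIndependent_bound`), and `(t^{⌈m/r⌉}+2)^{(2/3-δ) r} ≤ (t+2)^{(2/3-δ)(m+r)}`;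
  WLOG `δ ≤ 1/3` (the hypothesis is monotone in the exponent), so `c = 2/3 - δ ∈ [1/3, 2/3)`.
* `stub_residualSlope` (DECLARED RESIDUAL, never staffed by this line): `ResidualSlope := BeatTwoThirds → NewtonTauWeak` — the rest
  of the ladder (gap_after), crux-strength GIVEN the rung (`beatTwoThirds_and_residual_iff : BeatTwoThirds ∧ ResidualSlope ↔ NewtonTauWeak`,
  kernel-checked); it exists so that the registered skeleton concludes the crux BY NAME (`NewtonTauWeak_proof`), exactly as the sibling
  forward line `Cruxes/GronwallLeakage/Lines/exact_rung_log2.lean` (RH) declares `ResidualLog2`; by KPTT Prop. 1 it is NOT reachable by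
  this line's method family (F1: named, not attacked).
Compositions: `BeatTwoThirds_of` (the rung, by name: modus ponens) and `NewtonTauWeak_of : stub₁ → stub₂ → residual → crux`.  Tribunal probes (NOTES.md `birth-certificate:`): `BeatTwoThirds → NewtonTauWeak`
and `→ ValiantsHypothesis` do not close; `SlopeBound (2/3) → BeatTwoThirds` (floor → rung) does not close; `NewtonTauWeak → BeatTwoThirds` PROVED.

Disproof used (`Cruxes/NewtonTauWeak/Disproof.lean`): `not_newtonTauBoundNoM/NoK/NoT`, `newtonTauWeak_false_without_sparsity` honoured —
every rung keeps `k`, `m`, `t` and the `2^{b m}` budget (`SlopeBound c` is WEAKER than the crux for `c ≥ 0`, so no landed Negative lemma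
refutes a rung; the zonogon `Π_{j<m}(1 + X Y^j)` has `2m ≤ 2^{m}` vertices).
-/

set_option linter.dupNamespace false

namespace Summit.ValiantsHypothesis.ValiantsHypothesis.Cruxes.NewtonTauWeak.SlopeLadder

open scoped BigOperators Pointwise
open MvPolynomial
open Literature.Computability.AlgebraicComplexity (newtonVertexCount)
open Literature.Computability.AlgebraicComplexity.KPTT (theorem6 theorem6_holds card_support_prod_univ_le_pow)
open Summit.ValiantsHypothesis.ValiantsHypothesis.Theses.NewtonFrames (NewtonTauWeak)

noncomputable section

/-! ### The graded family (slope `c`) and the rungs -/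

/-- SLOPE-`c` BOUND: `vert(Σ_{i<k} Π_{j<m} f_ij) ≤ C (k+2)^b 2^{bm} (t+2)^b (t+2)^{c m}` for `t`-sparse bivariate `f_ij`
over `ℂ` (`newtonVertexCount` is the crux's literal vertex count).  Slope `1` trivial, slope `2/3` = KPTT Thm 6 (floor),
slope `0` ⟸ the crux. Monotone in `c` (`slopeBound_mono`). -/
def SlopeBound (c : ℝ) : Prop :=
  ∃ (C : ℝ) (b : ℕ), ∀ (k m t : ℕ) (f : Fin k → Fin m → MvPolynomial (Fin 2) ℂ),
    (∀ i j, (f i j).support.card ≤ t) →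
      (newtonVertexCount (∑ i, ∏ j, f i j) : ℝ) ≤
        C * ((k : ℝ) + 2) ^ b * 2 ^ (b * m) * ((t : ℝ) + 2) ^ b * ((t : ℝ) + 2) ^ (c * (m : ℝ))

/-- THE RUNG (this line's target): beat the Eisenbrand–Pach–Rothvoß–Sopher / KPTT slope `2/3` by a fixed amount. -/
def BeatTwoThirds : Prop := ∃ c : ℝ, c < 2 / 3 ∧ SlopeBound c

/-- Further rung: slope `1/2`. -/
def SlopeHalf : Prop := SlopeBound (1 / 2)

/-- Further rung: slope `1/3` — the ceiling of every Minkowski-convexity argument (KPTT Prop. 1: `M_m(t) ≥ t^{m/3} - 1`). -/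
def SlopeThird : Prop := SlopeBound (1 / 3)

/-- Limit rung of the family: every positive slope. Still strictly weaker than the crux (t-exponent `o(m)` vs `O(1)`)
and still not summit-deciding (census S-J(iii): transfer needs `(kt)`-exponent `o(m / log m)` with controlled constants). -/
def SubLinear : Prop := ∀ c : ℝ, 0 < c → SlopeBound c

/-- BLOCK CONVEXITY INPUT (pure discrete geometry; the [BBFKOTT10 §5] problem `M_r(N)` in exponent form): for some number of
blocks `r ≥ 2` and some `δ > 0`, convexly independent subsets of `P₁ + ⋯ + P_r` (`|P_i| ≤ N`, planar) have
`≤ C (N+2)^{(2/3-δ) r}` points.  Refuted for `r = 2, 3` (card §3); the content is `r ≥ 4`. -/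
def BlockConvexBound : Prop :=
  ∃ (r : ℕ) (δ C : ℝ), 2 ≤ r ∧ 0 < δ ∧
    ∀ (N : ℕ) (P : Fin r → Finset (Fin 2 → ℝ)) (S : Finset (Fin 2 → ℝ)),
      (∀ i, (P i).card ≤ N) → S ⊆ ∑ i, P i →
        ConvexIndependent ℝ (Subtype.val : ↥(S : Set (Fin 2 → ℝ)) → (Fin 2 → ℝ)) →
          (S.card : ℝ) ≤ C * ((N : ℝ) + 2) ^ ((2 / 3 - δ) * (r : ℝ))

/-! ### Registered stubs (`sorry` lives only here)

Each stub statement is written out IN FULL (no line-local abbreviation), so that the signature registered by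
`ledger skeleton check` is restatable verbatim in a `Theorems/` file (`propose --supports stmt-ValiantsHypothesis-5904`;
such a file needs `open scoped Pointwise` for the finset sum `∑ i, P i` in STUB 1/2).  `stubs_match_abbreviations` below
records that the full texts are the abbreviations `BlockConvexBound`, `BlockConvexBound → BeatTwoThirds`, `ResidualSlope`. -/

/-- STUB 1 (HARDEST, open convex geometry) = `BlockConvexBound` written out. Some block count `r` beats the per-block
exponent `2/3` for convexly independent subsets of `r`-fold planar Minkowski sums.  Size: open-problem (r = 2, 3 are tight
at `2/3`; nothing is known for `r ≥ 4` beyond `N^{r/3} - 1 ≤ M_r(N) ≤ O(N^{2r/3})`, [BBFKOTT10 §5], arXiv:1909.01189 §7).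
Cheapest falsifier: an explicit 4-set family with `N^{8/3 - o(1)}` points of `P₁+P₂+P₃+P₄` in convex position (search
degree-≤3 lifts `(i, αi²+βi³)` with two translation classes; card §5). -/
theorem stub_blockConvexBound :
    ∃ (r : ℕ) (δ C : ℝ), 2 ≤ r ∧ 0 < δ ∧
      ∀ (N : ℕ) (P : Fin r → Finset (Fin 2 → ℝ)) (S : Finset (Fin 2 → ℝ)),
        (∀ i, (P i).card ≤ N) → S ⊆ ∑ i, P i →
          ConvexIndependent ℝ (Subtype.val : ↥(S : Set (Fin 2 → ℝ)) → (Fin 2 → ℝ)) →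
            (S.card : ℝ) ≤ C * ((N : ℝ) + 2) ^ ((2 / 3 - δ) * (r : ℝ)) := by
  sorry

/-- STUB 2 (M/L, provable now) = `BlockConvexBound → BeatTwoThirds` written out. BLOCKING: the `r`-block version of KPTT's
proof of Theorem 6 turns the block convexity input `(r, δ, C)` into the slope `c := 2/3 - min δ (1/3) < 2/3`: partition
`Fin m` into `r` blocks of `≤ ⌈m/r⌉` factors (empty blocks have product `1`, support `{0}`), `P_b :=` embedded support of the
block product (`≤ t^{⌈m/r⌉}` points, `KPTT.card_support_prod_univ_le_pow`), the hull vertices of `Σ_i Π_j f_ij` lying in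
`supp Π_j f_ij` form a convexly independent subset of `Σ_b P_b` (`MvPolynomial.support_sum`, iterated `support_mul`, extreme
points of a union restricted to one piece, as in `KPTT.theorem5_of_minkowski_convexIndependent_bound`,
NewtonPolygonTauProofs.lean), then `(t^{⌈m/r⌉}+2)^{c r} ≤ 3^{c r}(t+2)^{c (m + r)}` and a factor `k` for the `k` products;
`b := ⌈c r⌉ + 2 r + 2` works (`r` is a constant of the hypothesis). -/
theorem stub_blocking :
    (∃ (r : ℕ) (δ C : ℝ), 2 ≤ r ∧ 0 < δ ∧
      ∀ (N : ℕ) (P : Fin r → Finset (Fin 2 → ℝ)) (S : Finset (Fin 2 → ℝ)),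
        (∀ i, (P i).card ≤ N) → S ⊆ ∑ i, P i →
          ConvexIndependent ℝ (Subtype.val : ↥(S : Set (Fin 2 → ℝ)) → (Fin 2 → ℝ)) →
            (S.card : ℝ) ≤ C * ((N : ℝ) + 2) ^ ((2 / 3 - δ) * (r : ℝ))) →
    ∃ c : ℝ, c < 2 / 3 ∧
      ∃ (C : ℝ) (b : ℕ), ∀ (k m t : ℕ) (f : Fin k → Fin m → MvPolynomial (Fin 2) ℂ),
        (∀ i j, (f i j).support.card ≤ t) →
          (Literature.Computability.AlgebraicComplexity.newtonVertexCount (∑ i, ∏ j, f i j) : ℝ) ≤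
            C * ((k : ℝ) + 2) ^ b * 2 ^ (b * m) * ((t : ℝ) + 2) ^ b * ((t : ℝ) + 2) ^ (c * (m : ℝ)) := by
  sorry

/-- DECLARED RESIDUAL (F8-style; not attacked by this line): the remainder of the slope ladder above the rung,
`BeatTwoThirds → NewtonTauWeak` (t-exponent `(2/3-δ)m` ⇝ `O(1)`).  Crux-strength given the rung
(`beatTwoThirds_and_residual_iff`); unreachable by block convexity (KPTT Prop. 1 caps the family at slope `1/3`);
its only purpose is to let the registered skeleton conclude the crux by name. Do NOT seat stub-workers on it. -/
def ResidualSlope : Prop := BeatTwoThirds → NewtonTauWeak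

/-- STUB 3 = the declared residual `ResidualSlope` written out (`BeatTwoThirds → Theses.NewtonFrames.NewtonTauWeak`;
summit-of-the-crux strength given the rung — NOT a prover target, never staffed; see `ResidualSlope`). -/
theorem stub_residualSlope :
    (∃ c : ℝ, c < 2 / 3 ∧
      ∃ (C : ℝ) (b : ℕ), ∀ (k m t : ℕ) (f : Fin k → Fin m → MvPolynomial (Fin 2) ℂ),
        (∀ i j, (f i j).support.card ≤ t) →
          (Literature.Computability.AlgebraicComplexity.newtonVertexCount (∑ i, ∏ j, f i j) : ℝ) ≤
            C * ((k : ℝ) + 2) ^ b * 2 ^ (b * m) * ((t : ℝ) + 2) ^ b * ((t : ℝ) + 2) ^ (c * (m : ℝ))) →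
    Summit.ValiantsHypothesis.ValiantsHypothesis.Theses.NewtonFrames.NewtonTauWeak := by
  sorry

/-! ### Name-keyed aliases of the stub statements (hypotheses of the composition) -/
namespace Registered

/-- Alias of the statement of STUB 1, keyed by the registered stub name. -/
abbrev stub_blockConvexBound : Prop := BlockConvexBound

/-- Alias of the statement of STUB 2, keyed by the registered stub name. -/
abbrev stub_blocking : Prop := BlockConvexBound → BeatTwoThirds

/-- Alias of the statement of STUB 3 (declared residual). -/
abbrev stub_residualSlope : Prop := ResidualSlope

end Registered

/-- Bookkeeping (kernel-checked): the three full stub texts ARE the line's abbreviations, by `δ`-unfolding. -/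
theorem stubs_match_abbreviations :
    (Registered.stub_blockConvexBound ↔
      ∃ (r : ℕ) (δ C : ℝ), 2 ≤ r ∧ 0 < δ ∧
        ∀ (N : ℕ) (P : Fin r → Finset (Fin 2 → ℝ)) (S : Finset (Fin 2 → ℝ)),
          (∀ i, (P i).card ≤ N) → S ⊆ ∑ i, P i →
            ConvexIndependent ℝ (Subtype.val : ↥(S : Set (Fin 2 → ℝ)) → (Fin 2 → ℝ)) →
              (S.card : ℝ) ≤ C * ((N : ℝ) + 2) ^ ((2 / 3 - δ) * (r : ℝ))) ∧
    (Registered.stub_residualSlope ↔ (BeatTwoThirds → NewtonTauWeak)) ∧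
    (BeatTwoThirds ↔ ∃ c : ℝ, c < 2 / 3 ∧
      ∃ (C : ℝ) (b : ℕ), ∀ (k m t : ℕ) (f : Fin k → Fin m → MvPolynomial (Fin 2) ℂ),
        (∀ i j, (f i j).support.card ≤ t) →
          (Literature.Computability.AlgebraicComplexity.newtonVertexCount (∑ i, ∏ j, f i j) : ℝ) ≤
            C * ((k : ℝ) + 2) ^ b * 2 ^ (b * m) * ((t : ℝ) + 2) ^ b * ((t : ℝ) + 2) ^ (c * (m : ℝ))) :=
  ⟨Iff.rfl, Iff.rfl, Iff.rfl⟩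

/-! ### Composition (PROVED): the stubs give the RUNG by name -/

/-- The registered stubs compose to the rung `BeatTwoThirds` (modus ponens; the rung, not the crux, is this line's target —
forward discipline F2: `NewtonTauWeak → BeatTwoThirds` is `beatTwoThirds_of_newtonTauWeak`, the converse is the ladder's gap). -/
theorem BeatTwoThirds_of (h₁ : Registered.stub_blockConvexBound) (h₂ : Registered.stub_blocking) : BeatTwoThirds :=
  h₂ h₁

/-- The rung from the stubs as they stand (`sorry` only inside `stub_*`). -/
theorem BeatTwoThirds_of_stubs : BeatTwoThirds :=
  BeatTwoThirds_of stub_blockConvexBound stub_blocking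

/-- The crux BY NAME from the two real stubs and the declared residual (registered skeleton theorem). -/
theorem NewtonTauWeak_of (h₁ : Registered.stub_blockConvexBound) (h₂ : Registered.stub_blocking)
    (h₃ : Registered.stub_residualSlope) : NewtonTauWeak :=
  h₃ (h₂ h₁)

/-- `ledger skeleton check` entry point: the crux `Theses.NewtonFrames.NewtonTauWeak` BY NAME from the stubs as they stand
(`sorry` only inside `stub_*`). -/
theorem NewtonTauWeak_proof : NewtonTauWeak :=
  NewtonTauWeak_of stub_blockConvexBound stub_blocking stub_residualSlope

/-- The same skeleton concludes the CLOSED route's copy of the shared decl (identical body; `δ`-unfolding). -/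
theorem NewtonTauWeak_proof_unitEquations :
    Summit.ValiantsHypothesis.ValiantsHypothesis.Theses.NewtonUnitEquations.NewtonTauWeak :=
  NewtonTauWeak_proof

/-! ### Calibration (PROVED): support count, monotonicity, the trivial rung, the FLOOR (F3 witness), on-path (F4) -/

/-- The Newton vertex count is at most the number of monomials. [folklore] -/
theorem newtonVertexCount_le_card (p : MvPolynomial (Fin 2) ℂ) : newtonVertexCount p ≤ p.support.card := by
  classical
  calc newtonVertexCount p
      ≤ ((fun e : Fin 2 →₀ ℕ => fun i : Fin 2 => ((e i : ℕ) : ℝ)) '' (p.support : Set (Fin 2 →₀ ℕ))).ncard :=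
        Set.ncard_le_ncard extremePoints_convexHull_subset ((p.support.finite_toSet).image _)
    _ ≤ (p.support : Set (Fin 2 →₀ ℕ)).ncard := Set.ncard_image_le p.support.finite_toSet
    _ = p.support.card := Set.ncard_coe_finset _

/-- `Σ_{i<k} Π_{j<m} f_ij` with `t`-sparse factors has at most `k t^m` monomials. [folklore; KPTT §2] -/
theorem card_support_sum_prod_le {k m t : ℕ} (f : Fin k → Fin m → MvPolynomial (Fin 2) ℂ)
    (hf : ∀ i j, (f i j).support.card ≤ t) : (∑ i, ∏ j, f i j).support.card ≤ k * t ^ m := by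
  classical
  calc (∑ i, ∏ j, f i j).support.card
      ≤ (Finset.univ.biUnion fun i => (∏ j, f i j).support).card := Finset.card_le_card MvPolynomial.support_sum
    _ ≤ ∑ i, (∏ j, f i j).support.card := Finset.card_biUnion_le
    _ ≤ ∑ _i : Fin k, t ^ m := Finset.sum_le_sum fun i _ => card_support_prod_univ_le_pow (f i) (hf i)
    _ = k * t ^ m := by simp

/-- The trivial vertex bound `vert ≤ k t^m` (slope `1`). [KPTT §2] -/
theorem newtonVertexCount_sum_prod_le {k m t : ℕ} (f : Fin k → Fin m → MvPolynomial (Fin 2) ℂ)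
    (hf : ∀ i j, (f i j).support.card ≤ t) : newtonVertexCount (∑ i, ∏ j, f i j) ≤ k * t ^ m :=
  (newtonVertexCount_le_card _).trans (card_support_sum_prod_le f hf)

/-- Monotonicity of the family in the slope. -/
theorem slopeBound_mono {c c' : ℝ} (hcc' : c ≤ c') (h : SlopeBound c) : SlopeBound c' := by
  obtain ⟨C, b, hC⟩ := h
  refine ⟨max C 0, b, fun k m t f hf => ?_⟩
  have ht1 : (1 : ℝ) ≤ (t : ℝ) + 2 := by have := (Nat.cast_nonneg t : (0 : ℝ) ≤ t); linarith
  have hexp : ((t : ℝ) + 2) ^ (c * (m : ℝ)) ≤ ((t : ℝ) + 2) ^ (c' * (m : ℝ)) :=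
    Real.rpow_le_rpow_of_exponent_le ht1 (mul_le_mul_of_nonneg_right hcc' (Nat.cast_nonneg m))
  have hM : (0 : ℝ) ≤ max C 0 := le_max_right _ _
  calc (newtonVertexCount (∑ i, ∏ j, f i j) : ℝ)
      ≤ C * ((k : ℝ) + 2) ^ b * 2 ^ (b * m) * ((t : ℝ) + 2) ^ b * ((t : ℝ) + 2) ^ (c * (m : ℝ)) := hC k m t f hf
    _ ≤ max C 0 * ((k : ℝ) + 2) ^ b * 2 ^ (b * m) * ((t : ℝ) + 2) ^ b * ((t : ℝ) + 2) ^ (c * (m : ℝ)) := by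
        gcongr
        exact le_max_left _ _
    _ ≤ max C 0 * ((k : ℝ) + 2) ^ b * 2 ^ (b * m) * ((t : ℝ) + 2) ^ b * ((t : ℝ) + 2) ^ (c' * (m : ℝ)) :=
        mul_le_mul_of_nonneg_left hexp (by positivity)

/-- The trivial rung: slope `1` (support counting). -/
theorem slopeBound_one : SlopeBound 1 := by
  refine ⟨1, 1, fun k m t f hf => ?_⟩
  have hnat : newtonVertexCount (∑ i, ∏ j, f i j) ≤ (k + 2) * (t + 2) ^ m :=
    (newtonVertexCount_sum_prod_le f hf).trans
      (Nat.mul_le_mul (Nat.le_add_right k 2) (Nat.pow_le_pow_left (Nat.le_add_right t 2) m))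
  have hreal : (newtonVertexCount (∑ i, ∏ j, f i j) : ℝ) ≤ ((k : ℝ) + 2) * ((t : ℝ) + 2) ^ m := by
    exact_mod_cast hnat
  have ht1 : (1 : ℝ) ≤ (t : ℝ) + 2 := by have := (Nat.cast_nonneg t : (0 : ℝ) ≤ t); linarith
  have hrpow : ((t : ℝ) + 2) ^ ((1 : ℝ) * (m : ℝ)) = ((t : ℝ) + 2) ^ m := by
    rw [one_mul, Real.rpow_natCast]
  have hextra : (1 : ℝ) ≤ 2 ^ (1 * m) * ((t : ℝ) + 2) ^ 1 :=
    one_le_mul_of_one_le_of_one_le (one_le_pow₀ (by norm_num)) (by rw [pow_one]; exact ht1)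
  calc (newtonVertexCount (∑ i, ∏ j, f i j) : ℝ)
      ≤ ((k : ℝ) + 2) * ((t : ℝ) + 2) ^ m := hreal
    _ = ((k : ℝ) + 2) * ((t : ℝ) + 2) ^ m * 1 := (mul_one _).symm
    _ ≤ ((k : ℝ) + 2) * ((t : ℝ) + 2) ^ m * (2 ^ (1 * m) * ((t : ℝ) + 2) ^ 1) := by gcongr
    _ = 1 * ((k : ℝ) + 2) ^ 1 * 2 ^ (1 * m) * ((t : ℝ) + 2) ^ 1 * ((t : ℝ) + 2) ^ ((1 : ℝ) * (m : ℝ)) := by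
        rw [hrpow]; ring

/-- **THE FLOOR (F3 witness).** Slope `2/3` holds: KPTT Theorem 6 (`KPTT.theorem6_holds`, proved in the tree from the
Eisenbrand–Pach–Rothvoß–Sopher theorem `KPTT.card_le_of_convexIndependent_subset_add`) for `m ≥ 2`, support counting for `m ≤ 1`. -/
theorem slopeBound_two_thirds : SlopeBound (2 / 3) := by
  obtain ⟨C, hC⟩ := theorem6_holds
  refine ⟨max C 1, 1, fun k m t f hf => ?_⟩
  have hk0 : (0 : ℝ) ≤ k := Nat.cast_nonneg k
  have ht0 : (0 : ℝ) ≤ t := Nat.cast_nonneg t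
  have ht1 : (1 : ℝ) ≤ (t : ℝ) + 2 := by linarith
  have hM1 : (1 : ℝ) ≤ max C 1 := le_max_right _ _
  have hT1 : (1 : ℝ) ≤ ((t : ℝ) + 2) ^ (2 / 3 * (m : ℝ)) := Real.one_le_rpow ht1 (by positivity)
  have h2m : (1 : ℝ) ≤ 2 ^ (1 * m) := one_le_pow₀ (by norm_num)
  have ht21 : (1 : ℝ) ≤ ((t : ℝ) + 2) ^ 1 := by rw [pow_one]; exact ht1
  by_cases hm : 2 ≤ m
  · -- KPTT Theorem 6
    have h6 : (newtonVertexCount (∑ i, ∏ j, f i j) : ℝ) ≤ C * k * (t : ℝ) ^ (2 * (m : ℝ) / 3) :=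
      hC ℂ k m t f hm hf
    have hT : (t : ℝ) ^ (2 * (m : ℝ) / 3) ≤ ((t : ℝ) + 2) ^ (2 / 3 * (m : ℝ)) := by
      rw [show (2 * (m : ℝ) / 3) = 2 / 3 * (m : ℝ) by ring]
      exact Real.rpow_le_rpow ht0 (by linarith) (by positivity)
    calc (newtonVertexCount (∑ i, ∏ j, f i j) : ℝ)
        ≤ C * k * (t : ℝ) ^ (2 * (m : ℝ) / 3) := h6
      _ ≤ max C 1 * k * (t : ℝ) ^ (2 * (m : ℝ) / 3) := by gcongr; exact le_max_left _ _
      _ ≤ max C 1 * ((k : ℝ) + 2) * ((t : ℝ) + 2) ^ (2 / 3 * (m : ℝ)) := by gcongr; linarith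
      _ = max C 1 * ((k : ℝ) + 2) * ((t : ℝ) + 2) ^ (2 / 3 * (m : ℝ)) * 1 := (mul_one _).symm
      _ ≤ max C 1 * ((k : ℝ) + 2) * ((t : ℝ) + 2) ^ (2 / 3 * (m : ℝ)) * (2 ^ (1 * m) * ((t : ℝ) + 2) ^ 1) := by
          gcongr
          exact one_le_mul_of_one_le_of_one_le h2m ht21
      _ = max C 1 * ((k : ℝ) + 2) ^ 1 * 2 ^ (1 * m) * ((t : ℝ) + 2) ^ 1 * ((t : ℝ) + 2) ^ (2 / 3 * (m : ℝ)) := by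
          ring
  · -- m ≤ 1: support counting
    have hnat : newtonVertexCount (∑ i, ∏ j, f i j) ≤ (k + 2) * (t + 2) := by
      refine (newtonVertexCount_sum_prod_le f hf).trans ?_
      rcases (show m = 0 ∨ m = 1 by omega) with rfl | rfl
      · simp only [pow_zero, mul_one]; nlinarith
      · simp only [pow_one]; nlinarith
    have hreal : (newtonVertexCount (∑ i, ∏ j, f i j) : ℝ) ≤ ((k : ℝ) + 2) * ((t : ℝ) + 2) := by
      exact_mod_cast hnat
    calc (newtonVertexCount (∑ i, ∏ j, f i j) : ℝ)
        ≤ ((k : ℝ) + 2) * ((t : ℝ) + 2) := hreal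
      _ = ((k : ℝ) + 2) * ((t : ℝ) + 2) * 1 := (mul_one _).symm
      _ ≤ ((k : ℝ) + 2) * ((t : ℝ) + 2) * (max C 1 * 2 ^ (1 * m) * ((t : ℝ) + 2) ^ (2 / 3 * (m : ℝ))) := by
          gcongr
          exact one_le_mul_of_one_le_of_one_le (one_le_mul_of_one_le_of_one_le hM1 h2m) hT1
      _ = max C 1 * ((k : ℝ) + 2) ^ 1 * 2 ^ (1 * m) * ((t : ℝ) + 2) ^ 1 * ((t : ℝ) + 2) ^ (2 / 3 * (m : ℝ)) := by
          ring

/-- F3: the rung family specialises to the proved floor. -/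
example : SlopeBound (2 / 3) := slopeBound_two_thirds

/-- **ON-PATH (F4): the crux implies every nonnegative slope**, in particular the rung. (`(kt+2)^b ≤ (k+2)^b (t+2)^b`,
`2^{am} ≤ 2^{(a+b)m}`, `(t+2)^{cm} ≥ 1`.) -/
theorem slopeBound_of_newtonTauWeak {c : ℝ} (hc : 0 ≤ c) (h : NewtonTauWeak) : SlopeBound c := by
  obtain ⟨a, b, hab⟩ := h
  refine ⟨1, a + b, fun k m t f hf => ?_⟩
  have h1 : newtonVertexCount (∑ i, ∏ j, f i j) ≤ 2 ^ (a * m) * (k * t + 2) ^ b := hab k m t f hf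
  have h2 : 2 ^ (a * m) * (k * t + 2) ^ b ≤ (k + 2) ^ (a + b) * 2 ^ ((a + b) * m) * (t + 2) ^ (a + b) := by
    have e1 : 2 ^ (a * m) ≤ 2 ^ ((a + b) * m) :=
      Nat.pow_le_pow_right (by norm_num) (Nat.mul_le_mul_right m (Nat.le_add_right a b))
    have e2 : (k * t + 2) ^ b ≤ ((k + 2) * (t + 2)) ^ b := Nat.pow_le_pow_left (by nlinarith) b
    have e3 : ((k + 2) * (t + 2)) ^ b ≤ ((k + 2) * (t + 2)) ^ (a + b) :=
      Nat.pow_le_pow_right (by nlinarith) (Nat.le_add_left b a)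
    calc 2 ^ (a * m) * (k * t + 2) ^ b ≤ 2 ^ ((a + b) * m) * ((k + 2) * (t + 2)) ^ (a + b) :=
          Nat.mul_le_mul e1 (e2.trans e3)
      _ = (k + 2) ^ (a + b) * 2 ^ ((a + b) * m) * (t + 2) ^ (a + b) := by rw [mul_pow]; ring
  have h3 : (newtonVertexCount (∑ i, ∏ j, f i j) : ℝ) ≤
      ((k : ℝ) + 2) ^ (a + b) * 2 ^ ((a + b) * m) * ((t : ℝ) + 2) ^ (a + b) := by
    exact_mod_cast h1.trans h2
  have ht1 : (1 : ℝ) ≤ (t : ℝ) + 2 := by have := (Nat.cast_nonneg t : (0 : ℝ) ≤ t); linarith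
  have hX : (1 : ℝ) ≤ ((t : ℝ) + 2) ^ (c * (m : ℝ)) := Real.one_le_rpow ht1 (mul_nonneg hc (Nat.cast_nonneg m))
  calc (newtonVertexCount (∑ i, ∏ j, f i j) : ℝ)
      ≤ ((k : ℝ) + 2) ^ (a + b) * 2 ^ ((a + b) * m) * ((t : ℝ) + 2) ^ (a + b) := h3
    _ = ((k : ℝ) + 2) ^ (a + b) * 2 ^ ((a + b) * m) * ((t : ℝ) + 2) ^ (a + b) * 1 := (mul_one _).symm
    _ ≤ ((k : ℝ) + 2) ^ (a + b) * 2 ^ ((a + b) * m) * ((t : ℝ) + 2) ^ (a + b) * ((t : ℝ) + 2) ^ (c * (m : ℝ)) := by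
        gcongr
    _ = 1 * ((k : ℝ) + 2) ^ (a + b) * 2 ^ ((a + b) * m) * ((t : ℝ) + 2) ^ (a + b) * ((t : ℝ) + 2) ^ (c * (m : ℝ)) := by
        ring

/-- ON-PATH for the rung: `NewtonTauWeak → BeatTwoThirds` (slope `0 < 2/3`). -/
theorem beatTwoThirds_of_newtonTauWeak (h : NewtonTauWeak) : BeatTwoThirds :=
  ⟨0, by norm_num, slopeBound_of_newtonTauWeak le_rfl h⟩

/-- ON-PATH for the limit rung: `NewtonTauWeak → SubLinear`. -/
theorem subLinear_of_newtonTauWeak (h : NewtonTauWeak) : SubLinear :=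
  fun _c hc => slopeBound_of_newtonTauWeak hc.le h

/-! ### The ladder above the rung (PROVED implications between typed rungs) -/

theorem slopeThird_of_subLinear (h : SubLinear) : SlopeThird := h _ (by norm_num)

theorem slopeHalf_of_slopeThird (h : SlopeThird) : SlopeHalf := slopeBound_mono (by norm_num) h

theorem beatTwoThirds_of_slopeHalf (h : SlopeHalf) : BeatTwoThirds := ⟨1 / 2, by norm_num, h⟩

theorem beatTwoThirds_of_slopeBound {c : ℝ} (hc : c < 2 / 3) (h : SlopeBound c) : BeatTwoThirds := ⟨c, hc, h⟩

/-- The residual is literally the gap implication. -/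
theorem residualSlope_iff : ResidualSlope ↔ (BeatTwoThirds → NewtonTauWeak) := Iff.rfl

/-- The crux implies the residual (so no Negative lemma refutes the residual without refuting the crux). -/
theorem residualSlope_of_newtonTauWeak (h : NewtonTauWeak) : ResidualSlope := fun _ => h

/-- RUNG ∧ RESIDUAL ⟺ CRUX (kernel-checked accounting of what the line does and does not attack). -/
theorem beatTwoThirds_and_residual_iff : (BeatTwoThirds ∧ ResidualSlope) ↔ NewtonTauWeak :=
  ⟨fun h => h.2 h.1, fun h => ⟨beatTwoThirds_of_newtonTauWeak h, residualSlope_of_newtonTauWeak h⟩⟩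

/-- The rung implies the floor's statement back (sanity: rung ≥ floor in strength). -/
theorem slopeBound_two_thirds_of_beatTwoThirds (h : BeatTwoThirds) : SlopeBound (2 / 3) := by
  obtain ⟨c, hc, h⟩ := h
  exact slopeBound_mono hc.le h

end

end Summit.ValiantsHypothesis.ValiantsHypothesis.Cruxes.NewtonTauWeak.SlopeLadder
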